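import Summits.QuantumFields.BalabanUV.Beta.NVertexEvenCarrierPeriodised
import Summits.QuantumFields.BalabanUV.Beta.NVertexEvenBorderTorus

/-!
# `BalabanUV.Beta.NVertexEvenCarrierTorus` — row D1 ∕ (C1), PART 23: **THE WOUND EVEN N-FAMILY ON THE TORUS IS THREE WORDS** — `perF T (dper T (wound WN♮))
# = ½•Σ_{orient} (perF T (vertex2OfK (AN) N T2_Nᵉ^{per,csf}) + perF T (mixOfK (AN) N M2_Nᵉ^{per,cs}) + perF T (mixOfK′ …))` (no response word), each read by PART 17's
# parents (`Θ Θ′ • 𝒯̂₂ᵉ`, `Θ Ŝ′ • ℳ̂₂ᵉ`), and **ON THE FIELD–FIELD BLOCK THE BI-VERTEX TABLE IS `cE₂ ·` THE WOUND EVEN WILSON BI-STENCIL** — the displayed reading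
# `perF_dper_wound_WN_evenHalf_inl_inl_eq_sum` of v5's H-row `hHN₂`'s RIGHT SIDE, PART 20's twin for the `ff` block, for road FP's `TowerHN2Row` to consume BY NAME

WHY.  Road FP g44 A-5 (journal l.67846) will display `H₂f := (perF T (dper T 𝒱₂(v,v′)))|ff`, `𝒱₂ = Σ_b Σ_{b′} hb hb′ · 𝒯₂ᵉ + Σ_b Σ_β (hb·hm′ + hb′·hm) · ℳ₂ᵉ`, and type
`TowerHN2Row`'s `hHN2_row_iff_junction` against a DISPLAYED torus reading of the wound even family's `ff` block, as `TowerQN2Row` did with PART 20 on the `μf` block.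
PART 22 `NVertexEvenCarrierPeriodised.dper_tsum_WN_evenHalf` periodised the wound even family to `W2SymOfK (AN R j) N 0 0 T2_Nᵉ^{per,csf} M2_Nᵉ^{per,cs}`; this file
reads it on the torus with the (C2) parents at ZERO first-order sockets (`CombHId2TorusSym.perF_W2SymOfK_slots`; PART 21 `W2OfK_zero_first` + `perF_add` on
`CombHId2FoldsSlots.decays_vertex2OfK_csf_per ∕ decays_mixOfK_cs_per`; the readers `perF_vertex2OfK_csf_per ∕ perF_mixOfK_cs_per`), and pulls `cE₂` out of the
bi-vertex table on the `(inl α, inl β)` entries (PART 21 `T2N_even_apply_inl_inl` under `Σ'_n`, PART 20 `perF_dper_apply_congr_entry`, `dper_smul ∕ perF_smul`).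

WHAT ([folklore] bookkeeping BY NAME; no `def`, no `def … : Prop`, nothing cited, 0 sorry; notation: `N := Lc^(j+1)`, `M = N·M′`, `Â := perF M (AN R j)`,
`Θ(u,κ;μ,y) := Â((u, inl κ),(wrapPt M (N•y), inr μ))`, `Ŝ(w,ρ;ν,y′) := Â((wrapPt M (N•w), inr ρ),(wrapPt M (N•y′), inr ν))`, `T2Eᵖᵉʳ ∕ M2Eᵖᵉʳ` PART 22's periodised even
tables, `W₂ᵉ := ½•(wilsonW₂ 3 (P.T (j+1)) + sgnK ∘ trK)`): §1 `periodCov_M2N_even`, `sum₄_mul_pull`; §2 **`perF_dper_tsum_WN_evenHalf`**, `perF_W2SymOfK_N_even`,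
**`perF_W2OfK_N_even`** (THREE words), `perF_vertex2OfK_N_even`, `perF_mixOfK_N_even`; §3 `perF_T2N_even_per_inl_inl`; §4 **`perF_dper_wound_WN_evenHalf_inl_inl_eq_sum`**.
WHAT THIS IS NOT: not the H-side word `H₂f` (the road's display) nor its junction rows `hJW ∕ hJM`, nor the order-2 Ward row `a2`; not the locks' values; nothing of Bałaban's
asserted, valued or discharged; 0 estimates beyond the cited parents' geometric series; 0∕4 row-D1 binders (hW, hR, D1Tel, D1Rep); ROOT M‴ p325680 ∕ P5c ∕ D6 untouched;
NOT (C1), NOT (T-ID), NOT D1, NEVER «G-an2-4 closed», NOT BetaPertH, NOT continuum, NOT Clay.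

HONEST DEPENDENCY (page 1, mandatory): continuum YM on T⁴ ⇐ BetaPertH ∧ nine spine estimates (0/9 proved); BetaPertH ⇐ (D1) ∧ (D4) ∧ CAP+tail;
G-an2-4 gates asym, D1 and NE2/3/4.  HONEST FRAMING (cell contract, verbatim): «discharging `BetaPertH` makes Bałaban's UV stability UNCONDITIONAL —
a real constructive-QFT result; it is NOT the continuum limit and NOT the Clay problem.»  ABSOLUTE RULE (cell charter, verbatim): «No internally-minted
statement may enter as a cited fact. Every hypothesis is either kernel-proved in this package or a verbatim quotation of a PUBLISHED theorem with page
reference. The manuscript(s) under audit are NOT citable for their own disputed steps — they are the thing under adjudication; programme-internal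
(2001/route/tribunal) claims are never citable.»  Row D1 ∕ (C1) OWNER an2 (b2b-balaban-beta-an2) gen 69, 2026-08-27.  No existing file touched.
-/

noncomputable section

open scoped BigOperators

namespace Summit.QuantumFields.BalabanUV.Beta.NVertexEvenCarrierTorus

open Finset
open Literature.MathematicalPhysics.QuantumFieldTheory
open Literature.MathematicalPhysics.QuantumFieldTheory.Balaban1983to89
open Literature.MathematicalPhysics.QuantumFieldTheory.Balaban1983to89.Beta
open B4TorusKernel.MultiPeriod (translate)
open B6Lemma24Torus (pbox)
open ExpKernelCalculus (MKer Decays BiLoc VertexFamily shiftK)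
open AffineAveraging (Site box)
open OneStepResolventKernel (Fib LocStencil)
open OneStepKernelFamily (vertexOfK)
open BalabanCompositeJets (LocStencil₂)
open BalabanStepW2 (M2Of)
open HessKerRate (biLoc_zero)
open WilsonBiStencil (wilsonW₂)
open SecondOrderResponse (vertex2OfK mixOfK W2OfK W2SymOfK LocStencilFM)
open Summit.QuantumFields.BalabanUV.Beta.TameKernelCalculus (trK trK_apply)
open Summit.QuantumFields.BalabanUV.Beta.BorderedHessian (sgnF sgnF_inl sgnK sgnK_apply)
open Summit.QuantumFields.BalabanUV.Beta.AxialDressingRooted (one_le_of_neZero)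
open Summit.QuantumFields.BalabanUV.Beta.SpineRooted (SpureRecOf T2RecOf)
open Summit.QuantumFields.BalabanUV.Beta.CompositeCorrectorDress (compChart)
open Summit.QuantumFields.BalabanUV.Beta.CompositeOneShotJets (tabsComp)
open Summit.QuantumFields.BalabanUV.Beta.CompositeOneShotJetData (Roots Pins AN AN_eq WN)
open Summit.QuantumFields.BalabanUV.Beta.FP.KernelPeriodisationFib (Idx perF perF_add perF_smul)
open Summit.QuantumFields.BalabanUV.Beta.FP.KernelPeriodisationFibLoc (dper)
open Summit.QuantumFields.BalabanUV.Beta.FP.PeriodisedBorderTables (dper_smul)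
open Summit.QuantumFields.BalabanUV.Beta.FP.TorusGaugeCovariancePairing (wrapPt)
open Summit.QuantumFields.BalabanUV.Beta.CombHId2TorusSym (decays_add_min perF_W2SymOfK_slots)
open Summit.QuantumFields.BalabanUV.Beta.CombHId2FoldsSlots (perF_vertex2OfK_csf_per decays_vertex2OfK_csf_per perF_mixOfK_cs_per decays_mixOfK_cs_per)
open Summit.QuantumFields.BalabanUV.Beta.NVertexWoundPeriodised (decays_AN_family)
open Summit.QuantumFields.BalabanUV.Beta.NVertexWoundTorus (translate_inv_AN periodCov_M2N)
open Summit.QuantumFields.BalabanUV.Beta.NVertexEvenBorderTorus (perF_dper_apply_congr_entry)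
open Summit.QuantumFields.BalabanUV.Beta.NVertexEvenCarrier (W2OfK_zero_first T2N_even_apply_inl_inl)
open Summit.QuantumFields.BalabanUV.Beta.NVertexEvenCarrierPeriodised (T2N_even_translate exists_locStencil₂_T2N_even exists_locStencilFM_M2N_even dper_zero dper_tsum_WN_evenHalf)

variable {Lc : ℕ} [NeZero Lc] (R : Roots Lc) (P : Pins) (j : ℕ) (M : Fin (3 + 1) → ℕ) [∀ μ, NeZero (M μ)] {M' : Fin (3 + 1) → ℕ}

/-! ## §1 Letters -/

section Letters

omit [∀ μ, NeZero (M μ)] [NeZero Lc] in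
/-- [folklore] the EVEN half of `M2_N` is jointly period covariant (fine block shift of the field bond and of the kernel arguments, coarse shift of the multiplier bond) —
PART 17 `periodCov_M2N` on both terms. -/
theorem periodCov_M2N_even (hLc : 1 ≤ Lc) (hM : ∀ i, M i = Lc ^ (j + 1) * M' i) (κ : Fin (3 + 1)) (u : Site (3 + 1)) (ρ : Fin (3 + 1)) (w m x z : Site (3 + 1)) (a c : Fib 3) :
    ((1 / 2 : ℝ) • (M2Of 3 (Lc ^ (j + 1)) (tabsComp (j + 1) hLc R.hr (P.cM (j + 1))).mixFF 0 κ (translate M u m) ρ (translate M' w m)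
        + sgnK (trK (M2Of 3 (Lc ^ (j + 1)) (tabsComp (j + 1) hLc R.hr (P.cM (j + 1))).mixFF 0 κ (translate M u m) ρ (translate M' w m)))))
        (translate M x m) (translate M z m) a c
      = ((1 / 2 : ℝ) • (M2Of 3 (Lc ^ (j + 1)) (tabsComp (j + 1) hLc R.hr (P.cM (j + 1))).mixFF 0 κ u ρ w
        + sgnK (trK (M2Of 3 (Lc ^ (j + 1)) (tabsComp (j + 1) hLc R.hr (P.cM (j + 1))).mixFF 0 κ u ρ w)))) x z a c := by
  simp only [Pi.smul_apply, Pi.add_apply, smul_eq_mul, sgnK_apply, trK_apply]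
  rw [periodCov_M2N R P j M hLc hM, periodCov_M2N R P j M hLc hM]

/-- [folklore] pulling a scalar out of a four-fold column-weighted sum (`Finset.mul_sum` + `ring` termwise). -/
theorem sum₄_mul_pull {α β γ δ : Type*} [Fintype α] [Fintype β] [Fintype γ] [Fintype δ] (r : ℝ) (A : α → β → ℝ) (B : γ → δ → ℝ) (C : α → β → γ → δ → ℝ) :
    ∑ a : α, ∑ b : β, ∑ c : γ, ∑ e : δ, A a b * (B c e * (r * C a b c e)) = r * ∑ a : α, ∑ b : β, ∑ c : γ, ∑ e : δ, A a b * (B c e * C a b c e) := by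
  simp only [Finset.mul_sum]
  exact Finset.sum_congr rfl fun a _ => Finset.sum_congr rfl fun b _ => Finset.sum_congr rfl fun c _ => Finset.sum_congr rfl fun e _ => by ring

end Letters

/-! ## §2 The torus readings of the wound even N-family -/

section Torus

variable [∀ μ, NeZero (M' μ)]

omit [∀ μ, NeZero (M' μ)] in
/-- [folklore] **`perF_dper_tsum_WN_evenHalf`** — the torus matrix of the wound EVEN N-family IS `perF M (W2SymOfK (AN R j) N 0 0 T2Eᵖᵉʳ M2Eᵖᵉʳ …)` (PART 22 under `perF M`). -/
theorem perF_dper_tsum_WN_evenHalf (hM : ∀ i, M i = Lc ^ (j + 1) * M' i) (μ : Fin (3 + 1)) (y : Site (3 + 1)) (ν : Fin (3 + 1)) (y' : Site (3 + 1)) :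
    perF M (dper M (fun x w a b => ∑' e : Site (3 + 1),
        ((1 / 2 : ℝ) • (WN R P j μ y ν (translate M' y' e) + sgnK (trK (WN R P j μ y ν (translate M' y' e))))) x w a b))
      = perF M (W2SymOfK (AN R j) (Lc ^ (j + 1)) (0 : Fin (3 + 1) → (Fin (3 + 1) → ℤ) → MKer (3 + 1) (Fib 3)) (0 : Fin (3 + 1) → (Fin (3 + 1) → ℤ) → MKer (3 + 1) (Fib 3))
          (fun κ u κ' u' => dper M (fun x z a c => ∑' n : Site (3 + 1),
            ((1 / 2 : ℝ) • (T2RecOf 3 (Lc ^ (j + 1)) (fun _ => compChart R.rc Lc (j + 1) (R.s (j + 1)) (Lc ^ (j + 1)))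
        (SpureRecOf 3 (Lc ^ (j + 1)) (tabsComp (j + 1) (one_le_of_neZero Lc) R.hr (P.cM (j + 1))).V
        (tabsComp (j + 1) (one_le_of_neZero Lc) R.hr (P.cM (j + 1))).H (fun _ => compChart R.rc Lc (j + 1) (R.s (j + 1)) (Lc ^ (j + 1)))
        (P.cE (j + 1)) (P.cVH (j + 1)) (P.cΛ (j + 1)))
        (tabsComp (j + 1) (one_le_of_neZero Lc) R.hr (P.cM (j + 1))).M (P.cE₂ (j + 1)) (P.cB (j + 1)) (P.T (j + 1))
        (tabsComp (j + 1) (one_le_of_neZero Lc) R.hr (P.cM (j + 1))).vh₂S (tabsComp (j + 1) (one_le_of_neZero Lc) R.hr (P.cM (j + 1))).mixFF 0 κ u κ' (translate M u' n)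
          + sgnK (trK (T2RecOf 3 (Lc ^ (j + 1)) (fun _ => compChart R.rc Lc (j + 1) (R.s (j + 1)) (Lc ^ (j + 1)))
        (SpureRecOf 3 (Lc ^ (j + 1)) (tabsComp (j + 1) (one_le_of_neZero Lc) R.hr (P.cM (j + 1))).V
        (tabsComp (j + 1) (one_le_of_neZero Lc) R.hr (P.cM (j + 1))).H (fun _ => compChart R.rc Lc (j + 1) (R.s (j + 1)) (Lc ^ (j + 1)))
        (P.cE (j + 1)) (P.cVH (j + 1)) (P.cΛ (j + 1)))
        (tabsComp (j + 1) (one_le_of_neZero Lc) R.hr (P.cM (j + 1))).M (P.cE₂ (j + 1)) (P.cB (j + 1)) (P.T (j + 1))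
        (tabsComp (j + 1) (one_le_of_neZero Lc) R.hr (P.cM (j + 1))).vh₂S (tabsComp (j + 1) (one_le_of_neZero Lc) R.hr (P.cM (j + 1))).mixFF 0 κ u κ' (translate M u' n))))) x z a c))
          (fun κ u ρ w => dper M (fun x z a c => ∑' n : Site (3 + 1),
            ((1 / 2 : ℝ) • (M2Of 3 (Lc ^ (j + 1)) (tabsComp (j + 1) (one_le_of_neZero Lc) R.hr (P.cM (j + 1))).mixFF 0 κ u ρ (translate M' w n) + sgnK (trK (M2Of 3 (Lc ^ (j + 1)) (tabsComp (j + 1) (one_le_of_neZero Lc) R.hr (P.cM (j + 1))).mixFF 0 κ u ρ (translate M' w n))))) x z a c)) μ y ν y') := by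
  rw [dper_tsum_WN_evenHalf R P j M hM μ y ν y']

/-- [folklore] **`perF_W2SymOfK_N_even` — `Ŵ♮` SPLITS BY ORIENTATION**: `perF M (W2SymOfK (AN) N 0 0 T2Eᵖᵉʳ M2Eᵖᵉʳ b b′) = ½•(perF M (W2OfK … b b′) + perF M (W2OfK … b′ b))`
(`CombHId2TorusSym.perF_W2SymOfK_slots` at the ZERO first-order sockets and PART 22's even-table letters; `dper_zero` restores the literal `0 0`). -/
theorem perF_W2SymOfK_N_even (hM : ∀ i, M i = Lc ^ (j + 1) * M' i) (μ : Fin (3 + 1)) (y : Site (3 + 1)) (ν : Fin (3 + 1)) (y' : Site (3 + 1)) :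
    perF M (W2SymOfK (AN R j) (Lc ^ (j + 1)) (0 : Fin (3 + 1) → (Fin (3 + 1) → ℤ) → MKer (3 + 1) (Fib 3)) (0 : Fin (3 + 1) → (Fin (3 + 1) → ℤ) → MKer (3 + 1) (Fib 3))
          (fun κ u κ' u' => dper M (fun x z a c => ∑' n : Site (3 + 1),
            ((1 / 2 : ℝ) • (T2RecOf 3 (Lc ^ (j + 1)) (fun _ => compChart R.rc Lc (j + 1) (R.s (j + 1)) (Lc ^ (j + 1)))
        (SpureRecOf 3 (Lc ^ (j + 1)) (tabsComp (j + 1) (one_le_of_neZero Lc) R.hr (P.cM (j + 1))).V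
        (tabsComp (j + 1) (one_le_of_neZero Lc) R.hr (P.cM (j + 1))).H (fun _ => compChart R.rc Lc (j + 1) (R.s (j + 1)) (Lc ^ (j + 1)))
        (P.cE (j + 1)) (P.cVH (j + 1)) (P.cΛ (j + 1)))
        (tabsComp (j + 1) (one_le_of_neZero Lc) R.hr (P.cM (j + 1))).M (P.cE₂ (j + 1)) (P.cB (j + 1)) (P.T (j + 1))
        (tabsComp (j + 1) (one_le_of_neZero Lc) R.hr (P.cM (j + 1))).vh₂S (tabsComp (j + 1) (one_le_of_neZero Lc) R.hr (P.cM (j + 1))).mixFF 0 κ u κ' (translate M u' n)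
          + sgnK (trK (T2RecOf 3 (Lc ^ (j + 1)) (fun _ => compChart R.rc Lc (j + 1) (R.s (j + 1)) (Lc ^ (j + 1)))
        (SpureRecOf 3 (Lc ^ (j + 1)) (tabsComp (j + 1) (one_le_of_neZero Lc) R.hr (P.cM (j + 1))).V
        (tabsComp (j + 1) (one_le_of_neZero Lc) R.hr (P.cM (j + 1))).H (fun _ => compChart R.rc Lc (j + 1) (R.s (j + 1)) (Lc ^ (j + 1)))
        (P.cE (j + 1)) (P.cVH (j + 1)) (P.cΛ (j + 1)))
        (tabsComp (j + 1) (one_le_of_neZero Lc) R.hr (P.cM (j + 1))).M (P.cE₂ (j + 1)) (P.cB (j + 1)) (P.T (j + 1))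
        (tabsComp (j + 1) (one_le_of_neZero Lc) R.hr (P.cM (j + 1))).vh₂S (tabsComp (j + 1) (one_le_of_neZero Lc) R.hr (P.cM (j + 1))).mixFF 0 κ u κ' (translate M u' n))))) x z a c))
          (fun κ u ρ w => dper M (fun x z a c => ∑' n : Site (3 + 1),
            ((1 / 2 : ℝ) • (M2Of 3 (Lc ^ (j + 1)) (tabsComp (j + 1) (one_le_of_neZero Lc) R.hr (P.cM (j + 1))).mixFF 0 κ u ρ (translate M' w n) + sgnK (trK (M2Of 3 (Lc ^ (j + 1)) (tabsComp (j + 1) (one_le_of_neZero Lc) R.hr (P.cM (j + 1))).mixFF 0 κ u ρ (translate M' w n))))) x z a c)) μ y ν y')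
      = (1 / 2 : ℝ) • (perF M (W2OfK (AN R j) (Lc ^ (j + 1)) (0 : Fin (3 + 1) → (Fin (3 + 1) → ℤ) → MKer (3 + 1) (Fib 3)) (0 : Fin (3 + 1) → (Fin (3 + 1) → ℤ) → MKer (3 + 1) (Fib 3))
            (fun κ u κ' u' => dper M (fun x z a c => ∑' n : Site (3 + 1),
            ((1 / 2 : ℝ) • (T2RecOf 3 (Lc ^ (j + 1)) (fun _ => compChart R.rc Lc (j + 1) (R.s (j + 1)) (Lc ^ (j + 1)))
        (SpureRecOf 3 (Lc ^ (j + 1)) (tabsComp (j + 1) (one_le_of_neZero Lc) R.hr (P.cM (j + 1))).V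
        (tabsComp (j + 1) (one_le_of_neZero Lc) R.hr (P.cM (j + 1))).H (fun _ => compChart R.rc Lc (j + 1) (R.s (j + 1)) (Lc ^ (j + 1)))
        (P.cE (j + 1)) (P.cVH (j + 1)) (P.cΛ (j + 1)))
        (tabsComp (j + 1) (one_le_of_neZero Lc) R.hr (P.cM (j + 1))).M (P.cE₂ (j + 1)) (P.cB (j + 1)) (P.T (j + 1))
        (tabsComp (j + 1) (one_le_of_neZero Lc) R.hr (P.cM (j + 1))).vh₂S (tabsComp (j + 1) (one_le_of_neZero Lc) R.hr (P.cM (j + 1))).mixFF 0 κ u κ' (translate M u' n)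
          + sgnK (trK (T2RecOf 3 (Lc ^ (j + 1)) (fun _ => compChart R.rc Lc (j + 1) (R.s (j + 1)) (Lc ^ (j + 1)))
        (SpureRecOf 3 (Lc ^ (j + 1)) (tabsComp (j + 1) (one_le_of_neZero Lc) R.hr (P.cM (j + 1))).V
        (tabsComp (j + 1) (one_le_of_neZero Lc) R.hr (P.cM (j + 1))).H (fun _ => compChart R.rc Lc (j + 1) (R.s (j + 1)) (Lc ^ (j + 1)))
        (P.cE (j + 1)) (P.cVH (j + 1)) (P.cΛ (j + 1)))
        (tabsComp (j + 1) (one_le_of_neZero Lc) R.hr (P.cM (j + 1))).M (P.cE₂ (j + 1)) (P.cB (j + 1)) (P.T (j + 1))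
        (tabsComp (j + 1) (one_le_of_neZero Lc) R.hr (P.cM (j + 1))).vh₂S (tabsComp (j + 1) (one_le_of_neZero Lc) R.hr (P.cM (j + 1))).mixFF 0 κ u κ' (translate M u' n))))) x z a c))
            (fun κ u ρ w => dper M (fun x z a c => ∑' n : Site (3 + 1),
            ((1 / 2 : ℝ) • (M2Of 3 (Lc ^ (j + 1)) (tabsComp (j + 1) (one_le_of_neZero Lc) R.hr (P.cM (j + 1))).mixFF 0 κ u ρ (translate M' w n) + sgnK (trK (M2Of 3 (Lc ^ (j + 1)) (tabsComp (j + 1) (one_le_of_neZero Lc) R.hr (P.cM (j + 1))).mixFF 0 κ u ρ (translate M' w n))))) x z a c)) μ y ν y')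
          + perF M (W2OfK (AN R j) (Lc ^ (j + 1)) (0 : Fin (3 + 1) → (Fin (3 + 1) → ℤ) → MKer (3 + 1) (Fib 3)) (0 : Fin (3 + 1) → (Fin (3 + 1) → ℤ) → MKer (3 + 1) (Fib 3))
            (fun κ u κ' u' => dper M (fun x z a c => ∑' n : Site (3 + 1),
            ((1 / 2 : ℝ) • (T2RecOf 3 (Lc ^ (j + 1)) (fun _ => compChart R.rc Lc (j + 1) (R.s (j + 1)) (Lc ^ (j + 1)))
        (SpureRecOf 3 (Lc ^ (j + 1)) (tabsComp (j + 1) (one_le_of_neZero Lc) R.hr (P.cM (j + 1))).V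
        (tabsComp (j + 1) (one_le_of_neZero Lc) R.hr (P.cM (j + 1))).H (fun _ => compChart R.rc Lc (j + 1) (R.s (j + 1)) (Lc ^ (j + 1)))
        (P.cE (j + 1)) (P.cVH (j + 1)) (P.cΛ (j + 1)))
        (tabsComp (j + 1) (one_le_of_neZero Lc) R.hr (P.cM (j + 1))).M (P.cE₂ (j + 1)) (P.cB (j + 1)) (P.T (j + 1))
        (tabsComp (j + 1) (one_le_of_neZero Lc) R.hr (P.cM (j + 1))).vh₂S (tabsComp (j + 1) (one_le_of_neZero Lc) R.hr (P.cM (j + 1))).mixFF 0 κ u κ' (translate M u' n)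
          + sgnK (trK (T2RecOf 3 (Lc ^ (j + 1)) (fun _ => compChart R.rc Lc (j + 1) (R.s (j + 1)) (Lc ^ (j + 1)))
        (SpureRecOf 3 (Lc ^ (j + 1)) (tabsComp (j + 1) (one_le_of_neZero Lc) R.hr (P.cM (j + 1))).V
        (tabsComp (j + 1) (one_le_of_neZero Lc) R.hr (P.cM (j + 1))).H (fun _ => compChart R.rc Lc (j + 1) (R.s (j + 1)) (Lc ^ (j + 1)))
        (P.cE (j + 1)) (P.cVH (j + 1)) (P.cΛ (j + 1)))
        (tabsComp (j + 1) (one_le_of_neZero Lc) R.hr (P.cM (j + 1))).M (P.cE₂ (j + 1)) (P.cB (j + 1)) (P.T (j + 1))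
        (tabsComp (j + 1) (one_le_of_neZero Lc) R.hr (P.cM (j + 1))).vh₂S (tabsComp (j + 1) (one_le_of_neZero Lc) R.hr (P.cM (j + 1))).mixFF 0 κ u κ' (translate M u' n))))) x z a c))
            (fun κ u ρ w => dper M (fun x z a c => ∑' n : Site (3 + 1),
            ((1 / 2 : ℝ) • (M2Of 3 (Lc ^ (j + 1)) (tabsComp (j + 1) (one_le_of_neZero Lc) R.hr (P.cM (j + 1))).mixFF 0 κ u ρ (translate M' w n) + sgnK (trK (M2Of 3 (Lc ^ (j + 1)) (tabsComp (j + 1) (one_le_of_neZero Lc) R.hr (P.cM (j + 1))).mixFF 0 κ u ρ (translate M' w n))))) x z a c)) ν y' μ y)) := by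
  obtain ⟨δG, CG, hδG, -, hG⟩ := decays_AN_family R j 0
  obtain ⟨C₂, δ₂, hδ₂, hS₂⟩ := exists_locStencil₂_T2N_even R P j
  obtain ⟨Cm, δm, hδm, hM₂⟩ := exists_locStencilFM_M2N_even R P j (one_le_of_neZero Lc)
  have h := perF_W2SymOfK_slots M hM (translate_inv_AN R j M hM) (by rw [AN_eq]; exact hG) hδG
    (S := (0 : Fin (3 + 1) → (Fin (3 + 1) → ℤ) → MKer (3 + 1) (Fib 3))) (fun _ _ _ _ _ _ _ => rfl) (fun κ u => biLoc_zero _ _ (1 : ℝ)) one_pos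
    (Mt := (0 : Fin (3 + 1) → (Fin (3 + 1) → ℤ) → MKer (3 + 1) (Fib 3))) (fun _ _ _ _ _ _ _ => rfl) (fun _ _ => biLoc_zero _ _ (1 : ℝ)) one_pos
    (T2N_even_translate R P j) hS₂ hδ₂ (periodCov_M2N_even R P j M (one_le_of_neZero Lc) hM) hM₂ hδm μ y ν y'
  simp only [Pi.zero_apply, dper_zero] at h
  exact h

/-- [folklore] **`perF_W2OfK_N_even` — THE THREE TORUS WORDS OF THE EVEN FAMILY** (no response word): `perF M (W2OfK (AN) N 0 0 T2Eᵖᵉʳ M2Eᵖᵉʳ b b′)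
= perF M (vertex2OfK (AN) N T2Eᵖᵉʳ b b′) + perF M (mixOfK (AN) N M2Eᵖᵉʳ b b′) + perF M (mixOfK (AN) N M2Eᵖᵉʳ b′ b)` (PART 21 `W2OfK_zero_first` + `perF_add` on the decaying words). -/
theorem perF_W2OfK_N_even (hM : ∀ i, M i = Lc ^ (j + 1) * M' i) (μ : Fin (3 + 1)) (y : Site (3 + 1)) (ν : Fin (3 + 1)) (y' : Site (3 + 1)) :
    perF M (W2OfK (AN R j) (Lc ^ (j + 1)) (0 : Fin (3 + 1) → (Fin (3 + 1) → ℤ) → MKer (3 + 1) (Fib 3)) (0 : Fin (3 + 1) → (Fin (3 + 1) → ℤ) → MKer (3 + 1) (Fib 3))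
          (fun κ u κ' u' => dper M (fun x z a c => ∑' n : Site (3 + 1),
            ((1 / 2 : ℝ) • (T2RecOf 3 (Lc ^ (j + 1)) (fun _ => compChart R.rc Lc (j + 1) (R.s (j + 1)) (Lc ^ (j + 1)))
        (SpureRecOf 3 (Lc ^ (j + 1)) (tabsComp (j + 1) (one_le_of_neZero Lc) R.hr (P.cM (j + 1))).V
        (tabsComp (j + 1) (one_le_of_neZero Lc) R.hr (P.cM (j + 1))).H (fun _ => compChart R.rc Lc (j + 1) (R.s (j + 1)) (Lc ^ (j + 1)))
        (P.cE (j + 1)) (P.cVH (j + 1)) (P.cΛ (j + 1)))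
        (tabsComp (j + 1) (one_le_of_neZero Lc) R.hr (P.cM (j + 1))).M (P.cE₂ (j + 1)) (P.cB (j + 1)) (P.T (j + 1))
        (tabsComp (j + 1) (one_le_of_neZero Lc) R.hr (P.cM (j + 1))).vh₂S (tabsComp (j + 1) (one_le_of_neZero Lc) R.hr (P.cM (j + 1))).mixFF 0 κ u κ' (translate M u' n)
          + sgnK (trK (T2RecOf 3 (Lc ^ (j + 1)) (fun _ => compChart R.rc Lc (j + 1) (R.s (j + 1)) (Lc ^ (j + 1)))
        (SpureRecOf 3 (Lc ^ (j + 1)) (tabsComp (j + 1) (one_le_of_neZero Lc) R.hr (P.cM (j + 1))).V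
        (tabsComp (j + 1) (one_le_of_neZero Lc) R.hr (P.cM (j + 1))).H (fun _ => compChart R.rc Lc (j + 1) (R.s (j + 1)) (Lc ^ (j + 1)))
        (P.cE (j + 1)) (P.cVH (j + 1)) (P.cΛ (j + 1)))
        (tabsComp (j + 1) (one_le_of_neZero Lc) R.hr (P.cM (j + 1))).M (P.cE₂ (j + 1)) (P.cB (j + 1)) (P.T (j + 1))
        (tabsComp (j + 1) (one_le_of_neZero Lc) R.hr (P.cM (j + 1))).vh₂S (tabsComp (j + 1) (one_le_of_neZero Lc) R.hr (P.cM (j + 1))).mixFF 0 κ u κ' (translate M u' n))))) x z a c))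
          (fun κ u ρ w => dper M (fun x z a c => ∑' n : Site (3 + 1),
            ((1 / 2 : ℝ) • (M2Of 3 (Lc ^ (j + 1)) (tabsComp (j + 1) (one_le_of_neZero Lc) R.hr (P.cM (j + 1))).mixFF 0 κ u ρ (translate M' w n) + sgnK (trK (M2Of 3 (Lc ^ (j + 1)) (tabsComp (j + 1) (one_le_of_neZero Lc) R.hr (P.cM (j + 1))).mixFF 0 κ u ρ (translate M' w n))))) x z a c)) μ y ν y')
      = perF M (vertex2OfK (AN R j) (Lc ^ (j + 1))
            (fun κ u κ' u' => dper M (fun x z a c => ∑' n : Site (3 + 1),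
            ((1 / 2 : ℝ) • (T2RecOf 3 (Lc ^ (j + 1)) (fun _ => compChart R.rc Lc (j + 1) (R.s (j + 1)) (Lc ^ (j + 1)))
        (SpureRecOf 3 (Lc ^ (j + 1)) (tabsComp (j + 1) (one_le_of_neZero Lc) R.hr (P.cM (j + 1))).V
        (tabsComp (j + 1) (one_le_of_neZero Lc) R.hr (P.cM (j + 1))).H (fun _ => compChart R.rc Lc (j + 1) (R.s (j + 1)) (Lc ^ (j + 1)))
        (P.cE (j + 1)) (P.cVH (j + 1)) (P.cΛ (j + 1)))
        (tabsComp (j + 1) (one_le_of_neZero Lc) R.hr (P.cM (j + 1))).M (P.cE₂ (j + 1)) (P.cB (j + 1)) (P.T (j + 1))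
        (tabsComp (j + 1) (one_le_of_neZero Lc) R.hr (P.cM (j + 1))).vh₂S (tabsComp (j + 1) (one_le_of_neZero Lc) R.hr (P.cM (j + 1))).mixFF 0 κ u κ' (translate M u' n)
          + sgnK (trK (T2RecOf 3 (Lc ^ (j + 1)) (fun _ => compChart R.rc Lc (j + 1) (R.s (j + 1)) (Lc ^ (j + 1)))
        (SpureRecOf 3 (Lc ^ (j + 1)) (tabsComp (j + 1) (one_le_of_neZero Lc) R.hr (P.cM (j + 1))).V
        (tabsComp (j + 1) (one_le_of_neZero Lc) R.hr (P.cM (j + 1))).H (fun _ => compChart R.rc Lc (j + 1) (R.s (j + 1)) (Lc ^ (j + 1)))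
        (P.cE (j + 1)) (P.cVH (j + 1)) (P.cΛ (j + 1)))
        (tabsComp (j + 1) (one_le_of_neZero Lc) R.hr (P.cM (j + 1))).M (P.cE₂ (j + 1)) (P.cB (j + 1)) (P.T (j + 1))
        (tabsComp (j + 1) (one_le_of_neZero Lc) R.hr (P.cM (j + 1))).vh₂S (tabsComp (j + 1) (one_le_of_neZero Lc) R.hr (P.cM (j + 1))).mixFF 0 κ u κ' (translate M u' n))))) x z a c)) μ y ν y')
        + perF M (mixOfK (AN R j) (Lc ^ (j + 1))
            (fun κ u ρ w => dper M (fun x z a c => ∑' n : Site (3 + 1),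
            ((1 / 2 : ℝ) • (M2Of 3 (Lc ^ (j + 1)) (tabsComp (j + 1) (one_le_of_neZero Lc) R.hr (P.cM (j + 1))).mixFF 0 κ u ρ (translate M' w n) + sgnK (trK (M2Of 3 (Lc ^ (j + 1)) (tabsComp (j + 1) (one_le_of_neZero Lc) R.hr (P.cM (j + 1))).mixFF 0 κ u ρ (translate M' w n))))) x z a c)) μ y ν y')
        + perF M (mixOfK (AN R j) (Lc ^ (j + 1))
            (fun κ u ρ w => dper M (fun x z a c => ∑' n : Site (3 + 1),
            ((1 / 2 : ℝ) • (M2Of 3 (Lc ^ (j + 1)) (tabsComp (j + 1) (one_le_of_neZero Lc) R.hr (P.cM (j + 1))).mixFF 0 κ u ρ (translate M' w n) + sgnK (trK (M2Of 3 (Lc ^ (j + 1)) (tabsComp (j + 1) (one_le_of_neZero Lc) R.hr (P.cM (j + 1))).mixFF 0 κ u ρ (translate M' w n))))) x z a c)) ν y' μ y) := by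
  obtain ⟨δG, CG, hδG, -, hG⟩ := decays_AN_family R j 0
  obtain ⟨C₂, δ₂, hδ₂, hS₂⟩ := exists_locStencil₂_T2N_even R P j
  obtain ⟨Cm, δm, hδm, hM₂⟩ := exists_locStencilFM_M2N_even R P j (one_le_of_neZero Lc)
  have hK : Decays (AN R j) CG δG := by rw [AN_eq]; exact hG
  obtain ⟨C1, -, h1⟩ := decays_vertex2OfK_csf_per M hM (translate_inv_AN R j M hM) hK hδG (T2N_even_translate R P j) hS₂ hδ₂ μ y ν y'
  obtain ⟨C2, -, h2⟩ := decays_mixOfK_cs_per M hM (translate_inv_AN R j M hM) hK hδG (periodCov_M2N_even R P j M (one_le_of_neZero Lc) hM) hM₂ hδm μ y ν y'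
  obtain ⟨C3, -, h3⟩ := decays_mixOfK_cs_per M hM (translate_inv_AN R j M hM) hK hδG (periodCov_M2N_even R P j M (one_le_of_neZero Lc) hM) hM₂ hδm ν y' μ y
  rw [W2OfK_zero_first, perF_add M (decays_add_min h1 h2) h3 (lt_min (half_pos hδ₂) (half_pos hδm)) (half_pos hδm),
    perF_add M h1 h2 (half_pos hδ₂) (half_pos hδm)]

omit [∀ μ, NeZero (M' μ)] in
/-- [folklore] **THE BI-VERTEX WORD OF THE EVEN FAMILY** (road (H)'s `colN̂·colN̂` shape; `CombHId2FoldsSlots.perF_vertex2OfK_csf_per` at the even table):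
`perF M (vertex2OfK (AN) N T2Eᵖᵉʳ μ y ν y′) P Q = Σ_{u,κ} Σ_{u′,κ′} Θ(u,κ;μ,y) · (Θ(u′,κ′;ν,y′) · perF M (T2Eᵖᵉʳ κ u κ′ u′) P Q)`. -/
theorem perF_vertex2OfK_N_even (hM : ∀ i, M i = Lc ^ (j + 1) * M' i) (μ : Fin (3 + 1)) (y : Site (3 + 1)) (ν : Fin (3 + 1)) (y' : Site (3 + 1)) (X Z : Idx M (Fib 3)) :
    perF M (vertex2OfK (AN R j) (Lc ^ (j + 1))
            (fun κ u κ' u' => dper M (fun x z a c => ∑' n : Site (3 + 1),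
            ((1 / 2 : ℝ) • (T2RecOf 3 (Lc ^ (j + 1)) (fun _ => compChart R.rc Lc (j + 1) (R.s (j + 1)) (Lc ^ (j + 1)))
        (SpureRecOf 3 (Lc ^ (j + 1)) (tabsComp (j + 1) (one_le_of_neZero Lc) R.hr (P.cM (j + 1))).V
        (tabsComp (j + 1) (one_le_of_neZero Lc) R.hr (P.cM (j + 1))).H (fun _ => compChart R.rc Lc (j + 1) (R.s (j + 1)) (Lc ^ (j + 1)))
        (P.cE (j + 1)) (P.cVH (j + 1)) (P.cΛ (j + 1)))
        (tabsComp (j + 1) (one_le_of_neZero Lc) R.hr (P.cM (j + 1))).M (P.cE₂ (j + 1)) (P.cB (j + 1)) (P.T (j + 1))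
        (tabsComp (j + 1) (one_le_of_neZero Lc) R.hr (P.cM (j + 1))).vh₂S (tabsComp (j + 1) (one_le_of_neZero Lc) R.hr (P.cM (j + 1))).mixFF 0 κ u κ' (translate M u' n)
          + sgnK (trK (T2RecOf 3 (Lc ^ (j + 1)) (fun _ => compChart R.rc Lc (j + 1) (R.s (j + 1)) (Lc ^ (j + 1)))
        (SpureRecOf 3 (Lc ^ (j + 1)) (tabsComp (j + 1) (one_le_of_neZero Lc) R.hr (P.cM (j + 1))).V
        (tabsComp (j + 1) (one_le_of_neZero Lc) R.hr (P.cM (j + 1))).H (fun _ => compChart R.rc Lc (j + 1) (R.s (j + 1)) (Lc ^ (j + 1)))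
        (P.cE (j + 1)) (P.cVH (j + 1)) (P.cΛ (j + 1)))
        (tabsComp (j + 1) (one_le_of_neZero Lc) R.hr (P.cM (j + 1))).M (P.cE₂ (j + 1)) (P.cB (j + 1)) (P.T (j + 1))
        (tabsComp (j + 1) (one_le_of_neZero Lc) R.hr (P.cM (j + 1))).vh₂S (tabsComp (j + 1) (one_le_of_neZero Lc) R.hr (P.cM (j + 1))).mixFF 0 κ u κ' (translate M u' n))))) x z a c)) μ y ν y') X Z
      = ∑ u : ↥(pbox M), ∑ κ : Fin (3 + 1), ∑ u' : ↥(pbox M), ∑ κ' : Fin (3 + 1),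
          perF M (AN R j) (u, Sum.inl κ) (wrapPt M (((Lc ^ (j + 1) : ℕ) : ℤ) • y), Sum.inr μ)
            * (perF M (AN R j) (u', Sum.inl κ') (wrapPt M (((Lc ^ (j + 1) : ℕ) : ℤ) • y'), Sum.inr ν)
                * perF M (dper M (fun x z a c => ∑' n : Site (3 + 1),
            ((1 / 2 : ℝ) • (T2RecOf 3 (Lc ^ (j + 1)) (fun _ => compChart R.rc Lc (j + 1) (R.s (j + 1)) (Lc ^ (j + 1)))
        (SpureRecOf 3 (Lc ^ (j + 1)) (tabsComp (j + 1) (one_le_of_neZero Lc) R.hr (P.cM (j + 1))).V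
        (tabsComp (j + 1) (one_le_of_neZero Lc) R.hr (P.cM (j + 1))).H (fun _ => compChart R.rc Lc (j + 1) (R.s (j + 1)) (Lc ^ (j + 1)))
        (P.cE (j + 1)) (P.cVH (j + 1)) (P.cΛ (j + 1)))
        (tabsComp (j + 1) (one_le_of_neZero Lc) R.hr (P.cM (j + 1))).M (P.cE₂ (j + 1)) (P.cB (j + 1)) (P.T (j + 1))
        (tabsComp (j + 1) (one_le_of_neZero Lc) R.hr (P.cM (j + 1))).vh₂S (tabsComp (j + 1) (one_le_of_neZero Lc) R.hr (P.cM (j + 1))).mixFF 0 κ (u : Site (3 + 1)) κ' (translate M (u' : Site (3 + 1)) n)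
          + sgnK (trK (T2RecOf 3 (Lc ^ (j + 1)) (fun _ => compChart R.rc Lc (j + 1) (R.s (j + 1)) (Lc ^ (j + 1)))
        (SpureRecOf 3 (Lc ^ (j + 1)) (tabsComp (j + 1) (one_le_of_neZero Lc) R.hr (P.cM (j + 1))).V
        (tabsComp (j + 1) (one_le_of_neZero Lc) R.hr (P.cM (j + 1))).H (fun _ => compChart R.rc Lc (j + 1) (R.s (j + 1)) (Lc ^ (j + 1)))
        (P.cE (j + 1)) (P.cVH (j + 1)) (P.cΛ (j + 1)))
        (tabsComp (j + 1) (one_le_of_neZero Lc) R.hr (P.cM (j + 1))).M (P.cE₂ (j + 1)) (P.cB (j + 1)) (P.T (j + 1))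
        (tabsComp (j + 1) (one_le_of_neZero Lc) R.hr (P.cM (j + 1))).vh₂S (tabsComp (j + 1) (one_le_of_neZero Lc) R.hr (P.cM (j + 1))).mixFF 0 κ (u : Site (3 + 1)) κ' (translate M (u' : Site (3 + 1)) n))))) x z a c)) X Z) := by
  obtain ⟨δG, CG, hδG, -, hG⟩ := decays_AN_family R j 0
  obtain ⟨C₂, δ₂, hδ₂, hS₂⟩ := exists_locStencil₂_T2N_even R P j
  exact perF_vertex2OfK_csf_per M hM (translate_inv_AN R j M hM) (by rw [AN_eq]; exact hG) hδG (T2N_even_translate R P j) hS₂ hδ₂ μ y ν y' X Z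

/-- [folklore] **THE MIXED WORD OF THE EVEN FAMILY** (either bond order; ONE `Θ`-column, ONE `Ŝ`-column; `CombHId2FoldsSlots.perF_mixOfK_cs_per` at the even table):
`perF M (mixOfK (AN) N M2Eᵖᵉʳ μ y ν y′) P Q = Σ_{u,κ} Σ_{w∈pbox M′,ρ} Θ(u,κ;μ,y) · (Ŝ(w,ρ;ν,y′) · perF M (M2Eᵖᵉʳ κ u ρ w) P Q)`. -/
theorem perF_mixOfK_N_even (hM : ∀ i, M i = Lc ^ (j + 1) * M' i) (μ : Fin (3 + 1)) (y : Site (3 + 1)) (ν : Fin (3 + 1)) (y' : Site (3 + 1)) (X Z : Idx M (Fib 3)) :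
    perF M (mixOfK (AN R j) (Lc ^ (j + 1))
            (fun κ u ρ w => dper M (fun x z a c => ∑' n : Site (3 + 1),
            ((1 / 2 : ℝ) • (M2Of 3 (Lc ^ (j + 1)) (tabsComp (j + 1) (one_le_of_neZero Lc) R.hr (P.cM (j + 1))).mixFF 0 κ u ρ (translate M' w n) + sgnK (trK (M2Of 3 (Lc ^ (j + 1)) (tabsComp (j + 1) (one_le_of_neZero Lc) R.hr (P.cM (j + 1))).mixFF 0 κ u ρ (translate M' w n))))) x z a c)) μ y ν y') X Z
      = ∑ u : ↥(pbox M), ∑ κ : Fin (3 + 1), ∑ w : ↥(pbox M'), ∑ ρ : Fin (3 + 1),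
          perF M (AN R j) (u, Sum.inl κ) (wrapPt M (((Lc ^ (j + 1) : ℕ) : ℤ) • y), Sum.inr μ)
            * (perF M (AN R j) (wrapPt M (((Lc ^ (j + 1) : ℕ) : ℤ) • (w : Site (3 + 1))), Sum.inr ρ) (wrapPt M (((Lc ^ (j + 1) : ℕ) : ℤ) • y'), Sum.inr ν)
                * perF M (dper M (fun x z a c => ∑' n : Site (3 + 1),
            ((1 / 2 : ℝ) • (M2Of 3 (Lc ^ (j + 1)) (tabsComp (j + 1) (one_le_of_neZero Lc) R.hr (P.cM (j + 1))).mixFF 0 κ (u : Site (3 + 1)) ρ (translate M' (w : Site (3 + 1)) n) + sgnK (trK (M2Of 3 (Lc ^ (j + 1)) (tabsComp (j + 1) (one_le_of_neZero Lc) R.hr (P.cM (j + 1))).mixFF 0 κ (u : Site (3 + 1)) ρ (translate M' (w : Site (3 + 1)) n))))) x z a c)) X Z) := by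
  obtain ⟨δG, CG, hδG, -, hG⟩ := decays_AN_family R j 0
  obtain ⟨Cm, δm, hδm, hM₂⟩ := exists_locStencilFM_M2N_even R P j (one_le_of_neZero Lc)
  exact perF_mixOfK_cs_per M hM (translate_inv_AN R j M hM) (by rw [AN_eq]; exact hG) hδG (periodCov_M2N_even R P j M (one_le_of_neZero Lc) hM) hM₂ hδm μ y ν y' X Z

end Torus

/-! ## §3 The field–field entries of the periodised even bi-vertex table -/

section Block

omit [∀ μ, NeZero (M μ)] in
/-- [folklore] **`perF_T2N_even_per_inl_inl` — on `(inl α, inl β)` the wound-periodised even table `T2Eᵖᵉʳ` is `cE₂ ·` the wound-periodised EVEN WILSON BI-STENCIL**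
(PART 21 `T2N_even_apply_inl_inl` under `Σ'_n` by `tsum_congr` + `tsum_mul_left` — no summability —, `perF ∘ dper` fibre-entrywise by PART 20 `perF_dper_apply_congr_entry`,
`dper_smul ∕ perF_smul`). -/
theorem perF_T2N_even_per_inl_inl (κ : Fin (3 + 1)) (u : Site (3 + 1)) (κ' : Fin (3 + 1)) (u' : Site (3 + 1)) (p q : ↥(pbox M)) (α β : Fin (3 + 1)) :
    perF M (dper M (fun x z a c => ∑' n : Site (3 + 1),
            ((1 / 2 : ℝ) • (T2RecOf 3 (Lc ^ (j + 1)) (fun _ => compChart R.rc Lc (j + 1) (R.s (j + 1)) (Lc ^ (j + 1)))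
        (SpureRecOf 3 (Lc ^ (j + 1)) (tabsComp (j + 1) (one_le_of_neZero Lc) R.hr (P.cM (j + 1))).V
        (tabsComp (j + 1) (one_le_of_neZero Lc) R.hr (P.cM (j + 1))).H (fun _ => compChart R.rc Lc (j + 1) (R.s (j + 1)) (Lc ^ (j + 1)))
        (P.cE (j + 1)) (P.cVH (j + 1)) (P.cΛ (j + 1)))
        (tabsComp (j + 1) (one_le_of_neZero Lc) R.hr (P.cM (j + 1))).M (P.cE₂ (j + 1)) (P.cB (j + 1)) (P.T (j + 1))
        (tabsComp (j + 1) (one_le_of_neZero Lc) R.hr (P.cM (j + 1))).vh₂S (tabsComp (j + 1) (one_le_of_neZero Lc) R.hr (P.cM (j + 1))).mixFF 0 κ u κ' (translate M u' n)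
          + sgnK (trK (T2RecOf 3 (Lc ^ (j + 1)) (fun _ => compChart R.rc Lc (j + 1) (R.s (j + 1)) (Lc ^ (j + 1)))
        (SpureRecOf 3 (Lc ^ (j + 1)) (tabsComp (j + 1) (one_le_of_neZero Lc) R.hr (P.cM (j + 1))).V
        (tabsComp (j + 1) (one_le_of_neZero Lc) R.hr (P.cM (j + 1))).H (fun _ => compChart R.rc Lc (j + 1) (R.s (j + 1)) (Lc ^ (j + 1)))
        (P.cE (j + 1)) (P.cVH (j + 1)) (P.cΛ (j + 1)))
        (tabsComp (j + 1) (one_le_of_neZero Lc) R.hr (P.cM (j + 1))).M (P.cE₂ (j + 1)) (P.cB (j + 1)) (P.T (j + 1))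
        (tabsComp (j + 1) (one_le_of_neZero Lc) R.hr (P.cM (j + 1))).vh₂S (tabsComp (j + 1) (one_le_of_neZero Lc) R.hr (P.cM (j + 1))).mixFF 0 κ u κ' (translate M u' n))))) x z a c)) (p, Sum.inl α) (q, Sum.inl β)
      = P.cE₂ (j + 1) * perF M (dper M (fun x z a c => ∑' n : Site (3 + 1),
            ((1 / 2 : ℝ) • (wilsonW₂ 3 (P.T (j + 1)) κ u κ' (translate M u' n) + sgnK (trK (wilsonW₂ 3 (P.T (j + 1)) κ u κ' (translate M u' n))))) x z a c)) (p, Sum.inl α) (q, Sum.inl β) := by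
  have hY : ∀ x w : Site (3 + 1),
      (fun x z a c => ∑' n : Site (3 + 1),
            ((1 / 2 : ℝ) • (T2RecOf 3 (Lc ^ (j + 1)) (fun _ => compChart R.rc Lc (j + 1) (R.s (j + 1)) (Lc ^ (j + 1)))
        (SpureRecOf 3 (Lc ^ (j + 1)) (tabsComp (j + 1) (one_le_of_neZero Lc) R.hr (P.cM (j + 1))).V
        (tabsComp (j + 1) (one_le_of_neZero Lc) R.hr (P.cM (j + 1))).H (fun _ => compChart R.rc Lc (j + 1) (R.s (j + 1)) (Lc ^ (j + 1)))
        (P.cE (j + 1)) (P.cVH (j + 1)) (P.cΛ (j + 1)))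
        (tabsComp (j + 1) (one_le_of_neZero Lc) R.hr (P.cM (j + 1))).M (P.cE₂ (j + 1)) (P.cB (j + 1)) (P.T (j + 1))
        (tabsComp (j + 1) (one_le_of_neZero Lc) R.hr (P.cM (j + 1))).vh₂S (tabsComp (j + 1) (one_le_of_neZero Lc) R.hr (P.cM (j + 1))).mixFF 0 κ u κ' (translate M u' n)
          + sgnK (trK (T2RecOf 3 (Lc ^ (j + 1)) (fun _ => compChart R.rc Lc (j + 1) (R.s (j + 1)) (Lc ^ (j + 1)))
        (SpureRecOf 3 (Lc ^ (j + 1)) (tabsComp (j + 1) (one_le_of_neZero Lc) R.hr (P.cM (j + 1))).V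
        (tabsComp (j + 1) (one_le_of_neZero Lc) R.hr (P.cM (j + 1))).H (fun _ => compChart R.rc Lc (j + 1) (R.s (j + 1)) (Lc ^ (j + 1)))
        (P.cE (j + 1)) (P.cVH (j + 1)) (P.cΛ (j + 1)))
        (tabsComp (j + 1) (one_le_of_neZero Lc) R.hr (P.cM (j + 1))).M (P.cE₂ (j + 1)) (P.cB (j + 1)) (P.T (j + 1))
        (tabsComp (j + 1) (one_le_of_neZero Lc) R.hr (P.cM (j + 1))).vh₂S (tabsComp (j + 1) (one_le_of_neZero Lc) R.hr (P.cM (j + 1))).mixFF 0 κ u κ' (translate M u' n))))) x z a c) x w (Sum.inl α) (Sum.inl β)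
        = ((P.cE₂ (j + 1)) • fun x z a c => ∑' n : Site (3 + 1),
            ((1 / 2 : ℝ) • (wilsonW₂ 3 (P.T (j + 1)) κ u κ' (translate M u' n) + sgnK (trK (wilsonW₂ 3 (P.T (j + 1)) κ u κ' (translate M u' n))))) x z a c) x w (Sum.inl α) (Sum.inl β) := fun x w => by
    simp only [Pi.smul_apply, smul_eq_mul]
    rw [← tsum_mul_left]
    exact tsum_congr fun n => T2N_even_apply_inl_inl R P j κ u κ' (translate M u' n) x w α β
  rw [perF_dper_apply_congr_entry M hY, dper_smul, perF_smul, Matrix.smul_apply, smul_eq_mul]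

end Block

/-! ## §4 The displayed reading of `hHN₂`'s right side on the field–field block -/

section Display

variable [∀ μ, NeZero (M' μ)]

/-- [folklore] **`perF_dper_wound_WN_evenHalf_inl_inl_eq_sum` — THE WOUND EVEN N-FAMILY's TORUS MATRIX ON THE FIELD–FIELD BLOCK** (`M = Lc^(j+1)·M′`; v5's `hHN₂` right side
per box at `M := towerTorus …`, `M′ := Mc B`, `j := n+1`): `perF M (dper M (x w ↦ Σ'_e WN♮ μ y ν (y′+M′∘e) x w)) (p, inl α) (q, inl β)
= cE₂ · ½(Σ_{u,κ} Σ_{u′,κ′} Θ(u,κ;μ,y)·(Θ(u′,κ′;ν,y′)·Ŵ₂ᵉ(κ,u,κ′,u′)) + Σ Θ(u,κ;ν,y′)·(Θ(u′,κ′;μ,y)·Ŵ₂ᵉ(κ,u,κ′,u′)))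
  + (Σ_{u,κ} Σ_{w,ρ} Θ(u,κ;μ,y)·(Ŝ(w,ρ;ν,y′)·ℳ̂₂ᵉ(κ,u,ρ,w)) + Σ Θ(u,κ;ν,y′)·(Ŝ(w,ρ;μ,y)·ℳ̂₂ᵉ(κ,u,ρ,w)))` at the entry `((p, inl α), (q, inl β))`,
`Ŵ₂ᵉ(κ,u,κ′,u′) := perF M (dper M (x z ↦ Σ'_n W₂ᵉ κ u κ′ (u′+M∘n) x z))`, `ℳ̂₂ᵉ(κ,u,ρ,w) := perF M (dper M (x z ↦ Σ'_n M2_Nᵉ κ u ρ (w+M′∘n) x z))` — THREE sectors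
(Wilson bi-vertex, two mixed), the `Θ`-columns road #6's `hJW`, the `Ŝ`-columns the road's `hJM` to display (A-5 (i)); NO response word, NO Λ-Hessian table, NO border table. -/
theorem perF_dper_wound_WN_evenHalf_inl_inl_eq_sum (hM : ∀ i, M i = Lc ^ (j + 1) * M' i)
    (μ : Fin (3 + 1)) (y : Site (3 + 1)) (ν : Fin (3 + 1)) (y' : Site (3 + 1)) (p q : ↥(pbox M)) (α β : Fin (3 + 1)) :
    perF M (dper M (fun x w a b => ∑' e : Site (3 + 1),
        ((1 / 2 : ℝ) • (WN R P j μ y ν (translate M' y' e) + sgnK (trK (WN R P j μ y ν (translate M' y' e))))) x w a b)) (p, Sum.inl α) (q, Sum.inl β)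
      = P.cE₂ (j + 1) * ((1 / 2 : ℝ) * ((∑ u : ↥(pbox M), ∑ κ : Fin (3 + 1), ∑ u' : ↥(pbox M), ∑ κ' : Fin (3 + 1),
          perF M (AN R j) (u, Sum.inl κ) (wrapPt M (((Lc ^ (j + 1) : ℕ) : ℤ) • y), Sum.inr μ)
            * (perF M (AN R j) (u', Sum.inl κ') (wrapPt M (((Lc ^ (j + 1) : ℕ) : ℤ) • y'), Sum.inr ν)
                * perF M (dper M (fun x z a c => ∑' n : Site (3 + 1),
            ((1 / 2 : ℝ) • (wilsonW₂ 3 (P.T (j + 1)) κ (u : Site (3 + 1)) κ' (translate M (u' : Site (3 + 1)) n) + sgnK (trK (wilsonW₂ 3 (P.T (j + 1)) κ (u : Site (3 + 1)) κ' (translate M (u' : Site (3 + 1)) n))))) x z a c)) (p, Sum.inl α) (q, Sum.inl β)))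
          + (∑ u : ↥(pbox M), ∑ κ : Fin (3 + 1), ∑ u' : ↥(pbox M), ∑ κ' : Fin (3 + 1),
          perF M (AN R j) (u, Sum.inl κ) (wrapPt M (((Lc ^ (j + 1) : ℕ) : ℤ) • y'), Sum.inr ν)
            * (perF M (AN R j) (u', Sum.inl κ') (wrapPt M (((Lc ^ (j + 1) : ℕ) : ℤ) • y), Sum.inr μ)
                * perF M (dper M (fun x z a c => ∑' n : Site (3 + 1),
            ((1 / 2 : ℝ) • (wilsonW₂ 3 (P.T (j + 1)) κ (u : Site (3 + 1)) κ' (translate M (u' : Site (3 + 1)) n) + sgnK (trK (wilsonW₂ 3 (P.T (j + 1)) κ (u : Site (3 + 1)) κ' (translate M (u' : Site (3 + 1)) n))))) x z a c)) (p, Sum.inl α) (q, Sum.inl β)))))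
        + ((∑ u : ↥(pbox M), ∑ κ : Fin (3 + 1), ∑ w : ↥(pbox M'), ∑ ρ : Fin (3 + 1),
          perF M (AN R j) (u, Sum.inl κ) (wrapPt M (((Lc ^ (j + 1) : ℕ) : ℤ) • y), Sum.inr μ)
            * (perF M (AN R j) (wrapPt M (((Lc ^ (j + 1) : ℕ) : ℤ) • (w : Site (3 + 1))), Sum.inr ρ) (wrapPt M (((Lc ^ (j + 1) : ℕ) : ℤ) • y'), Sum.inr ν)
                * perF M (dper M (fun x z a c => ∑' n : Site (3 + 1),
            ((1 / 2 : ℝ) • (M2Of 3 (Lc ^ (j + 1)) (tabsComp (j + 1) (one_le_of_neZero Lc) R.hr (P.cM (j + 1))).mixFF 0 κ (u : Site (3 + 1)) ρ (translate M' (w : Site (3 + 1)) n) + sgnK (trK (M2Of 3 (Lc ^ (j + 1)) (tabsComp (j + 1) (one_le_of_neZero Lc) R.hr (P.cM (j + 1))).mixFF 0 κ (u : Site (3 + 1)) ρ (translate M' (w : Site (3 + 1)) n))))) x z a c)) (p, Sum.inl α) (q, Sum.inl β)))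
          + (∑ u : ↥(pbox M), ∑ κ : Fin (3 + 1), ∑ w : ↥(pbox M'), ∑ ρ : Fin (3 + 1),
          perF M (AN R j) (u, Sum.inl κ) (wrapPt M (((Lc ^ (j + 1) : ℕ) : ℤ) • y'), Sum.inr ν)
            * (perF M (AN R j) (wrapPt M (((Lc ^ (j + 1) : ℕ) : ℤ) • (w : Site (3 + 1))), Sum.inr ρ) (wrapPt M (((Lc ^ (j + 1) : ℕ) : ℤ) • y), Sum.inr μ)
                * perF M (dper M (fun x z a c => ∑' n : Site (3 + 1),
            ((1 / 2 : ℝ) • (M2Of 3 (Lc ^ (j + 1)) (tabsComp (j + 1) (one_le_of_neZero Lc) R.hr (P.cM (j + 1))).mixFF 0 κ (u : Site (3 + 1)) ρ (translate M' (w : Site (3 + 1)) n) + sgnK (trK (M2Of 3 (Lc ^ (j + 1)) (tabsComp (j + 1) (one_le_of_neZero Lc) R.hr (P.cM (j + 1))).mixFF 0 κ (u : Site (3 + 1)) ρ (translate M' (w : Site (3 + 1)) n))))) x z a c)) (p, Sum.inl α) (q, Sum.inl β)))) := by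
  rw [perF_dper_tsum_WN_evenHalf R P j M hM, perF_W2SymOfK_N_even R P j M hM, Matrix.smul_apply, Matrix.add_apply,
    perF_W2OfK_N_even R P j M hM μ y ν y', perF_W2OfK_N_even R P j M hM ν y' μ y, Matrix.add_apply, Matrix.add_apply, Matrix.add_apply, Matrix.add_apply,
    perF_vertex2OfK_N_even R P j M hM μ y ν y', perF_vertex2OfK_N_even R P j M hM ν y' μ y,
    perF_mixOfK_N_even R P j M hM μ y ν y', perF_mixOfK_N_even R P j M hM ν y' μ y, smul_eq_mul]
  simp only [perF_T2N_even_per_inl_inl]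
  rw [sum₄_mul_pull, sum₄_mul_pull]
  ring

end Display

end Summit.QuantumFields.BalabanUV.Beta.NVertexEvenCarrierTorus

end
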